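import Mathlib
import HarnessLib

/-!
# Route NewtonUnitEquations — crux `TwoProducts` (stmt-ValiantsHypothesis-5906), line `formal-log-linearisation`:
# the lifted pencil count for ONE PAIR (`m = 1`): at most `s` visible points (theory lane on the OPEN stub 5)

Registered line `Cruxes/TwoProducts/Lines/formal-log-linearisation.lean` (NOT the item's skeleton of record; helper
mode `--supports stmt-ValiantsHypothesis-5906 --as helper`, no stub credit claimed).  Companion of
`Theorems/NewtonUnitEquationsTwoProductsFormalLogLinearisationLiftedBox.lean` (the BOX LEMMA) in the THEORY lane on the
line's OPEN engine `stub_logSumEngine`; see that file's docstring and the memo `memo-logSumEngine-core.md` (evidence on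
the item) for the LIFTED PENCIL COUNT — the necessary condition for the engine stating that the pencil-visible unequal
moments `μ` (`G(μ) = Σ_j A_j^μ − Σ_j B_j^μ ≠ 0`, `μ` the strict `(θ₁ + cθ₂)`-minimiser of `{G ≠ 0}` for some `c > 0`) of
two `m`-point configurations `A, B ⊂ ℂ^s` number at most `2^(a·m)(s+2)^b`.

This file settles its edge `m = 1` with the sharp count `s` (Mathlib only, no definitions; `G` inline):

* `OnePair.prod_pow_single`, `OnePair.wsum_single` — the unit vector `e_i`: `a^{e_i} = a_i`, `⟨θ, e_i⟩ = θ_i`;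
* `OnePair.exists_coord_of_prod_pow_ne` — if `∏ a_i^{μ_i} ≠ ∏ b_i^{μ_i}` then some `i` has `μ_i ≠ 0` and `a_i ≠ b_i`;
* `OnePair.eq_single_of_minimal` — for ONE PAIR (`G(μ) = a^μ − b^μ`) every strictly `θ`-minimal point of `{G ≠ 0}`
  (`θ` strictly positive) is a unit vector `e_i` with `a_i ≠ b_i`: such an `e_i` lies in `{G ≠ 0}` below `μ`;
* `liftedPencilCount_onePair` — hence, in the verbatim hypothesis shape of the lifted pencil count at `m = 1`
  (`A B : Fin 1 → Fin s → ℂ`), every finite set of pencil-visible points has at most `s` elements (indeed at most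
  `#{i : A₀ᵢ ≠ B₀ᵢ}`).

Honest framing: an elementary edge case for the THEORY lane of an OPEN engine (the content of the lifted count is
`m ≥ 2`, `s ≫ m / log m`); the engine `stub_logSumEngine` and the crux `TwoProducts` stay OPEN, the line is not the
item's skeleton of record, and nothing here is progress on `VP ≠ VNP` (NOT proved). No definitions, no named facts.
-/

noncomputable section

-- Sub = Summit single-conjunct layout: the duplicated namespace component is mandated by the tree.
set_option linter.dupNamespace false

namespace Summit.ValiantsHypothesis.ValiantsHypothesis.Theorems.NewtonUnitEquations.TwoProducts.FormalLogLinearisation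

open scoped BigOperators

namespace OnePair

variable {s : ℕ}

/-- `a^{e_i} = a_i` for the unit multi-index `e_i = Pi.single i 1`. [folklore] -/
theorem prod_pow_single (a : Fin s → ℂ) (i : Fin s) :
    ∏ i', a i' ^ (Pi.single i 1 : Fin s → ℕ) i' = a i := by
  classical
  rw [Finset.prod_eq_single i (fun i' _ hi' => by rw [Pi.single_eq_of_ne hi', pow_zero])
    (fun h => absurd (Finset.mem_univ i) h), Pi.single_eq_same, pow_one]

/-- `⟨θ, e_i⟩ = θ_i`. [folklore] -/
theorem wsum_single (θ : Fin s → ℝ) (i : Fin s) :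
    ∑ i', θ i' * ((Pi.single i 1 : Fin s → ℕ) i' : ℝ) = θ i := by
  classical
  rw [Finset.sum_eq_single i (fun i' _ hi' => by rw [Pi.single_eq_of_ne hi']; simp)
    (fun h => absurd (Finset.mem_univ i) h), Pi.single_eq_same]
  simp

/-- If `∏ a_i^{μ_i} ≠ ∏ b_i^{μ_i}` then some coordinate has `μ_i ≠ 0` and `a_i ≠ b_i`. [folklore] -/
theorem exists_coord_of_prod_pow_ne (a b : Fin s → ℂ) (μ : Fin s → ℕ)
    (h : ∏ i, a i ^ μ i ≠ ∏ i, b i ^ μ i) : ∃ i, μ i ≠ 0 ∧ a i ≠ b i := by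
  by_contra hno
  push Not at hno
  apply h
  refine Finset.prod_congr rfl fun i _ => ?_
  by_cases hμ : μ i = 0
  · rw [hμ, pow_zero, pow_zero]
  · rw [hno i hμ]

/-- **One pair: minimal points are unit vectors.**  For `G(μ) = a^μ − b^μ` and a strictly positive grading `θ`, if
`G(μ) ≠ 0` and every OTHER point `ν` of `{G ≠ 0}` is strictly `θ`-heavier than `μ`, then `μ = e_i` for some `i` with
`a_i ≠ b_i` (take `i` with `μ_i ≠ 0`, `a_i ≠ b_i`: `e_i ∈ {G ≠ 0}` and `⟨θ,e_i⟩ ≤ ⟨θ,μ⟩`, so `e_i = μ`). [folklore] -/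
theorem eq_single_of_minimal (a b : Fin s → ℂ) (θ : Fin s → ℝ) (hθ : ∀ i, 0 < θ i) (μ : Fin s → ℕ)
    (hμ : ∏ i, a i ^ μ i ≠ ∏ i, b i ^ μ i)
    (hstrict : ∀ ν : Fin s → ℕ, ν ≠ μ → ∏ i, a i ^ ν i ≠ ∏ i, b i ^ ν i →
      ∑ i, θ i * (μ i : ℝ) < ∑ i, θ i * (ν i : ℝ)) :
    ∃ i, a i ≠ b i ∧ μ = Pi.single i 1 := by
  classical
  obtain ⟨i, hμi, hab⟩ := exists_coord_of_prod_pow_ne a b μ hμ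
  refine ⟨i, hab, ?_⟩
  by_contra hne
  have hne' : (Pi.single i 1 : Fin s → ℕ) ≠ μ := fun h => hne h.symm
  have hG : ∏ i', a i' ^ (Pi.single i 1 : Fin s → ℕ) i' ≠ ∏ i', b i' ^ (Pi.single i 1 : Fin s → ℕ) i' := by
    rw [prod_pow_single, prod_pow_single]; exact hab
  have hlt := hstrict _ hne' hG
  rw [wsum_single] at hlt
  -- but `θ_i ≤ θ_i μ_i ≤ ⟨θ, μ⟩`
  have h1 : θ i ≤ θ i * (μ i : ℝ) := by
    have : (1 : ℝ) ≤ (μ i : ℝ) := by exact_mod_cast Nat.one_le_iff_ne_zero.mpr hμi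
    nlinarith [hθ i]
  have h2 : θ i * (μ i : ℝ) ≤ ∑ i', θ i' * (μ i' : ℝ) :=
    Finset.single_le_sum (f := fun i' => θ i' * (μ i' : ℝ))
      (fun i' _ => mul_nonneg (hθ i').le (Nat.cast_nonneg _)) (Finset.mem_univ i)
  linarith

end OnePair

/-- **Lifted pencil count, edge `m = 1`: at most `s` visible points.**  In the verbatim hypothesis shape of the lifted
pencil count (`A B : Fin 1 → Fin s → ℂ`, strictly positive `θ₁, θ₂`, visibility = `G(μ) ≠ 0` and strict
`(θ₁ + cθ₂)`-minimality in `{G ≠ 0}` for some `c > 0`), every finite set of pencil-visible multi-indices has at most `s`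
elements — each is a unit vector `e_i` with `A₀ᵢ ≠ B₀ᵢ` (`OnePair.eq_single_of_minimal`).  (The engine's shape
`2^(a·1)(s+2)^b` holds a fortiori; the content of the lifted count starts at `m = 2`.) [folklore] -/
theorem liftedPencilCount_onePair {s : ℕ} (A B : Fin 1 → Fin s → ℂ) (θ₁ θ₂ : Fin s → ℝ)
    (hθ₁ : ∀ i, 0 < θ₁ i) (hθ₂ : ∀ i, 0 < θ₂ i) (S : Finset (Fin s → ℕ))
    (hS : ∀ μ ∈ S, (∑ j, ∏ i, A j i ^ μ i) ≠ (∑ j, ∏ i, B j i ^ μ i) ∧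
      ∃ c : ℝ, 0 < c ∧ ∀ ν : Fin s → ℕ, ν ≠ μ →
        (∑ j, ∏ i, A j i ^ ν i) ≠ (∑ j, ∏ i, B j i ^ ν i) →
          ∑ i, (θ₁ i + c * θ₂ i) * (μ i : ℝ) < ∑ i, (θ₁ i + c * θ₂ i) * (ν i : ℝ)) :
    S.card ≤ s := by
  classical
  -- every visible point is a unit vector
  have hunit : ∀ μ ∈ S, μ ∈ (Finset.univ : Finset (Fin s)).image fun i => (Pi.single i 1 : Fin s → ℕ) := by
    intro μ hμS
    obtain ⟨hμ, c, hc, hstrict⟩ := hS μ hμS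
    simp only [Finset.univ_unique, Fin.default_eq_zero, Finset.sum_singleton] at hμ hstrict
    obtain ⟨i, -, rfl⟩ := OnePair.eq_single_of_minimal (A 0) (B 0) (fun i => θ₁ i + c * θ₂ i)
      (fun i => by have := hθ₁ i; have := hθ₂ i; positivity) μ hμ hstrict
    exact Finset.mem_image_of_mem _ (Finset.mem_univ i)
  calc S.card ≤ ((Finset.univ : Finset (Fin s)).image fun i => (Pi.single i 1 : Fin s → ℕ)).card :=
        Finset.card_le_card hunit
    _ ≤ (Finset.univ : Finset (Fin s)).card := Finset.card_image_le
    _ = s := Finset.card_fin s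

end Summit.ValiantsHypothesis.ValiantsHypothesis.Theorems.NewtonUnitEquations.TwoProducts.FormalLogLinearisation

end
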